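import Summits.Parity.BatemanHorn.Theses.AlmostPrimeZeros
import Summits.Parity.BatemanHorn.Theorems.SystemLSDRealSegment.Negative.Structure

/-!
# Line `beta-thinned-root-kernel` — checked skeleton for crux `SystemLSDRealSegment`
(item stmt-Parity-11292, route `AlmostPrimeZeros`, sub-problem `BatemanHorn`) — LEAD'S RESHAPE (rev L2)

Crux (by name, concluded by `SystemLSDRealSegment_of` below, fed by the stubs through
`systemLSDRealSegment_of_parts`):
`Summit.Parity.BatemanHorn.Theses.AlmostPrimeZeros.SystemLSDRealSegment`.

The line (idea card `Ideas/beta-thinned-root-kernel.md`, planner's card `Lines/beta-thinned-root-kernel.md`):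
Möbius-expand the tilt `y^{s(m)} = Σ_{d ∣ m} h_y(d)` (PROVED, `pow_capped_eq_sum_divisors`), sum over divisor
tuples, cut at the trivial level `∏ dᵢ ≤ x`: `M_x = T_x + K_x` (PROVED, `typeISum_add_kernelSum`).  The
Type-I part is a theorem for every system (Levin–Faĭnleĭb mean value of the CRT-multiplicative coefficient
`bCoeff`), with constant `λ_f(y)/Γ(k(y−1)+1)`, `λ_f = eulerFactor f` (`λ_f(0) = C(f)`, holomorphic); the
kernel `K_x` carries the forced complementary constant and is the crux's open content.

RESHAPE BY THE LEAD (2026-08-16, rev L1 -> L2: statements turned into predicates so the gate does not relocate them; planner's 5 stubs → 7, total ≤ stubs_max):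
* `stub_congruenceFacts : RootMertens ∧ LocalCounts` — M+M (Landau–Mertens for roots from the tree's
  `DegreeOnePrimesPNT`; Lagrange / resultant / Hensel counts at large primes).
* `stub_eulerFactor : LocalCounts → EulerFactorClause` — L (was `stub_eulerFactor`; the Hensel input is now
  an explicit hypothesis supplied by `stub_congruenceFacts`).
* `stub_levinFainleib : LevinFainleibAsymp` — L: the planner's `LevinFainleib` WITHOUT the `O((log D)^{κ−1})`
  rate (never consumed downstream), which makes it the PROVED tree Tauberian theorem
  `Literature.NumberTheory.LFunctions.HardyLittlewoodTauberianDirichlet_holds` (MV Thm 5.11, Karamata) applied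
  to `a_n = n g(n)`, plus the Abelian Euler-product computation `Σ g(d)d^{−s} ∼ P s^{−κ}`.
* `stub_typeISandwich` — L: `|T_x(y) − (x+1)Σ_{m≤x} b(m)| ≤ C(1 + Σ_{m≤x} m b(m))` (Fubini over tuples,
  complete residue systems; level free).
* `stub_typeILocal : LocalCounts → …` — XL: `b` non-negative, CRT-multiplicative, `b(p) = (y−1)Σρᵢ(p)/p`,
  `b(p^ν) = 0 (ν > 2k)`, `b(p^ν) ≤ C/p² (ν ≥ 2, p large)`, `Σ_ν b(p^ν) = E_p(y)`.
* `stub_typeILimit : (sandwich) → (local) → RootMertens → LevinFainleibAsymp → TypeILaw` — L (HT Thm 01 /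
  (0.4) of the tree for the a-priori bounds; `Σ m b(m) = o(x(log x)^κ)` from the asymptotic alone).
* `stub_betaKernel : BetaKernelLaw` — OPEN (hardest; the lead's).
The planner's `stub_rootMertens`, `stub_typeIReduction` are realised as `stub_congruenceFacts.1` and
`stub_typeILimit ∘ (stub_typeISandwich, stub_typeILocal)`; `stub_levinFainleib` is weakened to what is used.
The vocabulary below is VERBATIM the proposed `Theorems/AlmostPrimeZerosDefs.lean` (to be imported here once it
lands; Cruxes modules are not built on the farm, so the skeleton stays self-contained until then).

Disproof used: as in the planner's skeleton docstring (gen-2 `Disproof.lean`; `Negative.Structure` imported for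
`eulerFactor_unique_of_parts`).  `lean check`: rc 0, `sorry` exactly in the seven `stub_*`.
-/

open Filter Finset Polynomial
open scoped BigOperators Topology

namespace Summit.Parity.BatemanHorn.Cruxes.SystemLSDRealSegment.BetaThinnedRootKernel

open Literature.NumberTheory.Sieve
open Summit.Parity.BatemanHorn.Theses.AlmostPrimeZeros (SystemLSDRealSegment)

noncomputable section


section Weights

variable {R : Type*} [CommRing R]

/-- The capped statistic `s(m) = Σ_{p^v ∥ m} min(v, 2)` (verbatim the crux's inner sum; `s(0) = 0`).
[folklore] -/
def capped (m : ℕ) : ℕ := m.factorization.sum fun _ v => min v 2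

/-- Local coefficients of the thinned weight `h_y`: `h_y(p⁰) = 1`, `h_y(p) = y − 1`, `h_y(p²) = y² − y`,
`h_y(p^v) = 0` for `v ≥ 3` (the Möbius transform of `v ↦ y^{min(v,2)}`; all `≥ 0` for real `y ≥ 1`).
[folklore] -/
def thinCoeff (y : R) : ℕ → R
  | 0 => 1
  | 1 => y - 1
  | 2 => y ^ 2 - y
  | _ => 0

/-- `h_y(p⁰) = 1`. [folklore] -/
@[simp] theorem thinCoeff_zero (y : R) : thinCoeff y 0 = 1 := rfl

/-- `h_y(p) = y − 1`. [folklore] -/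
@[simp] theorem thinCoeff_one (y : R) : thinCoeff y 1 = y - 1 := rfl

/-- `h_y(p²) = y² − y`. [folklore] -/
@[simp] theorem thinCoeff_two (y : R) : thinCoeff y 2 = y ^ 2 - y := rfl

/-- `h_y(p^v) = 0` for `v ≥ 3` (the cap). [folklore] -/
theorem thinCoeff_of_three_le (y : R) {v : ℕ} (hv : 3 ≤ v) : thinCoeff y v = 0 := by
  obtain ⟨w, rfl⟩ := Nat.exists_eq_add_of_le hv
  rw [show 3 + w = w + 3 by omega]
  rfl

/-- The THINNED DIVISOR WEIGHT `h_y(d) = ∏_{p^v ∥ d} thinCoeff y v`: multiplicative, supported on the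
cube-free `d`; `y^{s(m)} = Σ_{d ∣ m} h_y(d)`.  (`h_y(0) = 1` is junk, never summed.) [folklore] -/
def thinWeight (y : R) (d : ℕ) : R := d.factorization.prod fun _ v => thinCoeff y v

/-- `h_y(1) = 1`. [folklore] -/
theorem thinWeight_one (y : R) : thinWeight y 1 = 1 := by simp [thinWeight]

/-- `h_y(p^j) = thinCoeff y j`. [folklore] -/
theorem thinWeight_prime_pow (y : R) {p : ℕ} (hp : p.Prime) (j : ℕ) :
    thinWeight y (p ^ j) = thinCoeff y j := by
  rw [thinWeight, hp.factorization_pow, Finsupp.prod_single_index]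
  exact thinCoeff_zero y

/-- `h_y(p) = y − 1`. [folklore] -/
theorem thinWeight_prime (y : R) {p : ℕ} (hp : p.Prime) : thinWeight y p = y - 1 := by
  simpa using thinWeight_prime_pow y hp 1

/-- `h_y` is multiplicative on coprime arguments. [folklore] -/
theorem thinWeight_mul (y : R) {m n : ℕ} (hm : m ≠ 0) (hn : n ≠ 0) (h : m.Coprime n) :
    thinWeight y (m * n) = thinWeight y m * thinWeight y n := by
  unfold thinWeight
  rw [Nat.factorization_mul hm hn, Finsupp.prod_add_index_of_disjoint]
  simpa only [Nat.support_factorization] using h.disjoint_primeFactors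

/-- `h_y(d)` over `ℂ` at a real `y` is the real weight cast. [folklore] -/
theorem thinWeight_ofReal (y : ℝ) (d : ℕ) : thinWeight (y : ℂ) d = ((thinWeight y d : ℝ) : ℂ) := by
  unfold thinWeight Finsupp.prod
  rw [Complex.ofReal_prod]
  refine Finset.prod_congr rfl fun p _ => ?_
  show thinCoeff (y : ℂ) (d.factorization p) = ((thinCoeff y (d.factorization p) : ℝ) : ℂ)
  rcases Nat.lt_or_ge (d.factorization p) 3 with h | h
  · interval_cases (d.factorization p) <;>
      simp only [thinCoeff_zero, thinCoeff_one, thinCoeff_two, Complex.ofReal_one, Complex.ofReal_sub,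
        Complex.ofReal_pow]
  · rw [thinCoeff_of_three_le _ h, thinCoeff_of_three_le _ h, Complex.ofReal_zero]

end Weights

/-! ### Divisor tuples, the Type-I sum and the beyond-level kernel -/

/-- Divisors with the convention `0 ↦ {1}`: the crux sends a value `fᵢ(n) ≤ 0` to `toNat = 0`, whose
statistic is `0 = s(1)`; with `divSet 0 = {1}` the expansion `y^{s(m)} = Σ_{d ∈ divSet m} h_y(d)` is
exact for EVERY `m : ℕ`. [folklore] -/
def divSet (m : ℕ) : Finset ℕ := (max m 1).divisors

/-- The divisor TUPLES of the values at `n`: `d = (dᵢ)`, `dᵢ ∈ divSet (fᵢ(n)).toNat`. [folklore] -/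
def tuples {k : ℕ} (f : Fin k → ℤ[X]) (n : ℕ) : Finset (Fin k → ℕ) :=
  Fintype.piFinset fun i => divSet ((f i).eval (n : ℤ)).toNat

/-- TYPE-I PART `T_x(y) = Σ_{0≤n≤x} Σ_{d ∈ tuples f n, ∏ dᵢ ≤ x} ∏ᵢ h_y(dᵢ)` (real). [folklore] -/
def typeISum {k : ℕ} (f : Fin k → ℤ[X]) (y : ℝ) (x : ℕ) : ℝ :=
  ∑ n ∈ range (x + 1), ∑ d ∈ (tuples f n).filter (fun d => ∏ i, d i ≤ x), ∏ i, thinWeight y (d i)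

/-- BEYOND-LEVEL KERNEL `K_x(y) = Σ_{0≤n≤x} Σ_{d ∈ tuples f n, x < ∏ dᵢ} ∏ᵢ h_y(dᵢ)` (real).
[folklore] -/
def kernelSum {k : ℕ} (f : Fin k → ℤ[X]) (y : ℝ) (x : ℕ) : ℝ :=
  ∑ n ∈ range (x + 1), ∑ d ∈ (tuples f n).filter (fun d => x < ∏ i, d i), ∏ i, thinWeight y (d i)

/-! ### Local and global Euler factors -/

/-- Capped `p`-adic order of an integer read modulo `p²`: `2` if `p² ∣ m`, `1` if `p ∣ m`, else `0`.
[folklore] -/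
def localExp (p : ℕ) (m : ℤ) : ℕ :=
  if (p : ℤ) ^ 2 ∣ m then 2 else if (p : ℤ) ∣ m then 1 else 0

/-- LOCAL FACTOR `E_p(z) = p⁻² Σ_{n mod p²} z^{Σᵢ localExp p (fᵢ(n))}` — the `p`-adic expectation of
`z^{s_{f,p}}`: a polynomial in `z` of degree `≤ 2k`, `E_p(0) = 1 − ω_f(p)/p`, `E_p(1) = 1`. [folklore] -/
def localFactor {k : ℕ} (f : Fin k → ℤ[X]) (p : ℕ) (z : ℂ) : ℂ :=
  ((p : ℂ) ^ 2)⁻¹ * ∑ n ∈ range (p ^ 2), z ^ (∑ i, localExp p ((f i).eval (n : ℤ)))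

/-- THE EXPLICIT EULER FACTOR `λ_f(z) = lim_N ∏_{p ≤ N} E_p(z)·(1 − 1/p)^{k(z−1)}` (ordered product,
as `batemanHornConst`; `(1−1/p)^{k(z−1)} = exp(k(z−1) log(1−1/p))`; junk if the limit does not
exist). [folklore] -/
def eulerFactor {k : ℕ} (f : Fin k → ℤ[X]) (z : ℂ) : ℂ :=
  limUnder atTop fun N : ℕ => ∏ p ∈ Nat.primesLE N,
    localFactor f p z * Complex.exp ((k : ℂ) * (z - 1) * (Real.log (1 - 1 / (p : ℝ)) : ℂ))

/-- Calibration `E_p(1) = 1`. [folklore] -/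
theorem localFactor_one {k : ℕ} (f : Fin k → ℤ[X]) {p : ℕ} (hp : p.Prime) : localFactor f p 1 = 1 := by
  have hp0 : (p : ℂ) ≠ 0 := by exact_mod_cast hp.ne_zero
  simp only [localFactor, one_pow, Finset.sum_const, Finset.card_range, nsmul_eq_mul, mul_one]
  push_cast
  exact inv_mul_cancel₀ (pow_ne_zero 2 hp0)

/-- Calibration `λ_f(1) = 1` for EVERY family. [folklore] -/
theorem eulerFactor_one {k : ℕ} (f : Fin k → ℤ[X]) : eulerFactor f 1 = 1 := by
  unfold eulerFactor
  have : (fun N : ℕ => ∏ p ∈ Nat.primesLE N,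
      localFactor f p 1 * Complex.exp ((k : ℂ) * (1 - 1) * (Real.log (1 - 1 / (p : ℝ)) : ℂ))) =
      fun _ => 1 := by
    funext N
    refine Finset.prod_eq_one fun p hp => ?_
    rw [localFactor_one f (Nat.mem_primesLE.1 hp).2, sub_self, mul_zero, zero_mul,
      Complex.exp_zero, mul_one]
  rw [this]
  exact tendsto_const_nhds.limUnder_eq

/-! ### Tuple densities and the Type-I coefficient `b` -/

/-- Tuples of positive integers with product EXACTLY `m` (as tuples of divisors of `m`; empty for
`m = 0`). [folklore] -/
def prodTuples (k m : ℕ) : Finset (Fin k → ℕ) :=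
  (Fintype.piFinset fun _ : Fin k => m.divisors).filter fun d => ∏ i, d i = m

/-- The period `lcm(d₁,…,d_k)` of the tuple condition `dᵢ ∣ fᵢ(n) ∀ i` (`= 1` for the empty tuple).
[folklore] -/
def tupleLcm {k : ℕ} (d : Fin k → ℕ) : ℕ := Finset.univ.lcm d

/-- `c_f(d) = #{n mod lcm d : dᵢ ∣ fᵢ(n) for every i}` — solutions of the tuple congruence in one
period. [folklore] -/
def tupleCount {k : ℕ} (f : Fin k → ℤ[X]) (d : Fin k → ℕ) : ℕ :=
  #((range (tupleLcm d)).filter fun n : ℕ => ∀ i, ((d i : ℕ) : ℤ) ∣ (f i).eval (n : ℤ))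

/-- The tuple density `δ_f(d) = c_f(d)/lcm(d)` (CRT-multiplicative in `d`). [folklore] -/
def tupleDens {k : ℕ} (f : Fin k → ℤ[X]) (d : Fin k → ℕ) : ℝ :=
  (tupleCount f d : ℝ) / (tupleLcm d : ℝ)

/-- THE TYPE-I COEFFICIENT `b_{f,y}(m) = Σ_{d : ∏dᵢ = m} ∏ᵢ h_y(dᵢ)·δ_f(d)`: non-negative and
multiplicative for `y ≥ 1`, `b(1) = 1`, `b(p) = (y−1)Σᵢρᵢ(p)/p`, `Σ_ν b(p^ν) = E_p(y)`, and
`T_x(y) = (x+1)Σ_{m≤x} b(m) +` (error). [folklore] -/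
def bCoeff {k : ℕ} (f : Fin k → ℤ[X]) (y : ℝ) (m : ℕ) : ℝ :=
  ∑ d ∈ prodTuples k m, (∏ i, thinWeight y (d i)) * tupleDens f d

/-! ### Statements of the line (the registered stub goals, as named predicates)

All statements are PREDICATES of the family / polynomial / function they speak about (the stubs quantify
over the parameters), so that each can be instantiated, landed and cited one case at a time. -/

/-- **EulerFactorClause k f**: if `f` is a Bateman–Horn system, `λ_f = eulerFactor f` is holomorphic on
`|z| < 2` and `λ_f(0) = batemanHornConst f`. [folklore] -/
def EulerFactorClause (k : ℕ) (f : Fin k → ℤ[X]) : Prop :=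
  IsBatemanHornSystem f →
    DifferentiableOn ℂ (eulerFactor f) (Metric.ball 0 2) ∧ eulerFactor f 0 = (batemanHornConst f : ℂ)

/-- **RootMertens g** (Landau 1903: Mertens' first theorem for the roots of a polynomial congruence):
if `g ∈ ℤ[X]` is irreducible and non-constant, `|Σ_{p ≤ Q} ρ_g(p) log p / p − log Q| ≤ C_g` for all
`Q ≥ 2`, `ρ_g(p) = polyRootCountMod ![g] p`. [folklore] -/
def RootMertens (g : ℤ[X]) : Prop :=
  Irreducible g → 0 < g.natDegree →
    ∃ C : ℝ, ∀ Q : ℕ, 2 ≤ Q →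
      |(∑ p ∈ Nat.primesLE Q, (polyRootCountMod ![g] p : ℝ) * Real.log p / p) - Real.log Q| ≤ C

/-- **LocalCounts k f** (the local inputs of a Bateman–Horn system at all large primes `p`): `p ∤ lc fᵢ`;
no common root of two members mod `p` (resultants, Bateman–Horn 1962 p. 364); and Hensel: at most
`deg fᵢ` residues `n mod p²` with `p² ∣ fᵢ(n)` (simple roots lift uniquely for `p ∤ Res(fᵢ, fᵢ′)`).
[folklore] -/
def LocalCounts (k : ℕ) (f : Fin k → ℤ[X]) : Prop :=
  IsBatemanHornSystem f →
    ∃ P₀ : ℕ, ∀ p : ℕ, p.Prime → P₀ < p →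
      (∀ i, ¬ (p : ℤ) ∣ (f i).leadingCoeff) ∧
      (∀ i j, i ≠ j → ∀ n : ℤ, ¬ ((p : ℤ) ∣ (f i).eval n ∧ (p : ℤ) ∣ (f j).eval n)) ∧
      (∀ i, #((range (p ^ 2)).filter fun n : ℕ => ((p : ℤ) ^ 2) ∣ (f i).eval (n : ℤ)) ≤ (f i).natDegree)

/-- **LevinFainleibAsymp g κ** (the logarithmic mean-value theorem for non-negative multiplicative
functions, asymptotic form with identified constant; Levin–Faĭnleĭb 1967, Halberstam–Richert 1974
Lemma 5.4, Ramaré 2022 Thm 13.3): `g ≥ 0` multiplicative, `κ ≥ 0`,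
(H1) `|Σ_{p ≤ Q} g(p) log p − κ log Q| ≤ L` (`Q ≥ 2`), (H2) `Σ_p g(p)² log p + Σ_p Σ_{ν≥2} g(p^ν) log p^ν ≤ A`
(bounded partial sums) ⇒ the ordered product `P = ∏_p (Σ_ν g(p^ν))(1 − 1/p)^κ` converges and
`Σ_{d ≤ D} g(d) ~ (P/Γ(κ+1)) (log D)^κ`. (Karamata/Hardy–Littlewood Tauberian route: the Dirichlet
series `Σ g(d)d^{−s} ∼ P s^{−κ}` as `s → 0⁺`.) [folklore] -/
def LevinFainleibAsymp (g : ℕ → ℝ) (κ : ℝ) : Prop :=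
  0 ≤ κ → (∀ n, 0 ≤ g n) → g 1 = 1 →
    (∀ m n : ℕ, m.Coprime n → g (m * n) = g m * g n) →
    (∃ L : ℝ, ∀ Q : ℕ, 2 ≤ Q →
      |(∑ p ∈ Nat.primesLE Q, g p * Real.log p) - κ * Real.log Q| ≤ L) →
    (∃ A : ℝ, ∀ N : ℕ,
      (∑ p ∈ Nat.primesLE N, g p ^ 2 * Real.log p) +
        (∑ p ∈ Nat.primesLE N, ∑ ν ∈ Icc 2 N, g (p ^ ν) * Real.log ((p : ℝ) ^ ν)) ≤ A) →
    ∃ P : ℝ,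
      Tendsto (fun N : ℕ => ∏ p ∈ Nat.primesLE N, (∑' ν : ℕ, g (p ^ ν)) * (1 - 1 / (p : ℝ)) ^ κ)
        atTop (𝓝 P) ∧
      Tendsto (fun D : ℕ => (∑ d ∈ Icc 1 D, g d) / Real.log D ^ κ) atTop
        (𝓝 (P / Real.Gamma (κ + 1)))

/-- **TypeISandwich k f y** (Fubini over divisor tuples + complete residue systems; the level `∏dᵢ ≤ x`
is free): `|T_x(y) − (x+1) Σ_{m≤x} b(m)| ≤ C (1 + Σ_{m≤x} m·b(m))`. [folklore] -/
def TypeISandwich (k : ℕ) (f : Fin k → ℤ[X]) (y : ℝ) : Prop :=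
  ∃ C : ℝ, ∀ x : ℕ,
    |typeISum f y x - ((x : ℝ) + 1) * ∑ m ∈ Icc 1 x, bCoeff f y m| ≤
      C * (1 + ∑ m ∈ Icc 1 x, (m : ℝ) * bCoeff f y m)

/-- **TypeILocal k f y** (structure of `b = bCoeff f y`): non-negative, `b(1) = 1`, multiplicative on
coprime arguments (CRT), `b(p) = (y−1)Σᵢρᵢ(p)/p` at every prime, `b(p^ν) = 0` for `ν > 2k`,
`b(p^ν) ≤ C/p²` for `2 ≤ ν` at all large `p`, and `Σ_{ν ≤ 2k} b(p^ν) = E_p(y)`. [folklore] -/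
def TypeILocal (k : ℕ) (f : Fin k → ℤ[X]) (y : ℝ) : Prop :=
  (∀ m, 0 ≤ bCoeff f y m) ∧ bCoeff f y 1 = 1 ∧
  (∀ m n : ℕ, m.Coprime n → bCoeff f y (m * n) = bCoeff f y m * bCoeff f y n) ∧
  (∀ p : ℕ, p.Prime → bCoeff f y p = (y - 1) * ∑ i, (polyRootCountMod ![f i] p : ℝ) / p) ∧
  (∀ p : ℕ, p.Prime → ∀ ν : ℕ, 2 * k < ν → bCoeff f y (p ^ ν) = 0) ∧
  (∃ P₀ : ℕ, ∃ C : ℝ, ∀ p : ℕ, p.Prime → P₀ < p → ∀ ν : ℕ, 2 ≤ ν →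
    bCoeff f y (p ^ ν) ≤ C / (p : ℝ) ^ 2) ∧
  (∀ p : ℕ, p.Prime →
    localFactor f p (y : ℂ) = ((∑ ν ∈ range (2 * k + 1), bCoeff f y (p ^ ν) : ℝ) : ℂ))

/-- **TypeILaw k f y** (the level-`x` half of the real-segment law):
`x⁻¹ (log x)^{k(1−y)} T_x(y) → λ_f(y)/Γ(k(y−1)+1)`, normaliser written exactly as in the crux
(claimed by the stubs for every Bateman–Horn system `f` and every real `y > 1`). [folklore] -/
def TypeILaw (k : ℕ) (f : Fin k → ℤ[X]) (y : ℝ) : Prop :=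
  Tendsto (fun x : ℕ => (x : ℂ)⁻¹ * Complex.exp ((k : ℂ) * (1 - (y : ℂ)) * (Real.log (Real.log x) : ℂ)) *
      (typeISum f y x : ℂ)) atTop
    (𝓝 (eulerFactor f y * (Complex.Gamma ((k : ℂ) * ((y : ℂ) - 1) + 1))⁻¹))

/-- **BetaKernelLaw k f y** (the beyond-level half; OPEN on the crux's segment):
`x⁻¹ (log x)^{k(1−y)} K_x(y) → λ_f(y)·(D^{y−1}Γ(y)^{−k} − Γ(k(y−1)+1)^{−1})`, `D = ∏ deg fᵢ`.
[folklore] -/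
def BetaKernelLaw (k : ℕ) (f : Fin k → ℤ[X]) (y : ℝ) : Prop :=
  Tendsto (fun x : ℕ => (x : ℂ)⁻¹ * Complex.exp ((k : ℂ) * (1 - (y : ℂ)) * (Real.log (Real.log x) : ℂ)) *
      (kernelSum f y x : ℂ)) atTop
    (𝓝 (eulerFactor f y *
      (Complex.exp (((y : ℂ) - 1) * (Real.log (∏ i, ((f i).natDegree : ℝ)) : ℂ)) * (Complex.Gamma y)⁻¹ ^ k -
        (Complex.Gamma ((k : ℂ) * ((y : ℂ) - 1) + 1))⁻¹)))


/-! ### The registered stubs (rev L2: statements are predicates; the stubs quantify) -/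

/-- **stub_congruenceFacts** (M+M; provable now from the tree).  (1) `RootMertens g`: monic case = the PROVED
`Literature.NumberTheory.LFunctions.DegreeOnePrimes.abs_sum_primesLE_rootCount_mul_log_sub_self_le_logPow`
(Chebyshev for roots with rate) fed to `MertensPrimeIdeals.abs_sum_div_sub_log_le` (partial summation); general
`g` through `irreducible_integralNormalization` / `polyRootCountMod_integralNormalization` (finitely many `p ∣ lc g`
move the sum by `O(1)`).  (2) `LocalCounts k f`: `p ∤ lc fᵢ` for `p > lc`; no common root mod `p` of `fᵢ, fⱼ`
for `p ∤ c`, `fᵢ a + fⱼ b = c ≠ 0` (`exists_mul_add_mul_eq_C_of_not_associated`); Hensel: for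
`p ∤ Res(fᵢ, fᵢ′) ≠ 0` (irreducible ⇒ separable over `ℚ`), a root `r mod p` has `p ∤ fᵢ′(r)` and
`fᵢ(r + tp) ≡ fᵢ(r) + tp fᵢ′(r) (mod p²)`, so exactly one lift: `#{n mod p² : p² ∣ fᵢ(n)} = ρᵢ(p) ≤ deg fᵢ`. -/
theorem stub_congruenceFacts :
    (∀ g : ℤ[X], RootMertens g) ∧ (∀ (k : ℕ) (f : Fin k → ℤ[X]), LocalCounts k f) := by
  sorry

/-- **stub_eulerFactor** (L; provable now).  On `|z| < 2` and for `p > P₀` (from `LocalCounts`):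
`p²·E_p(z) = p² + pω_f(p)(z − 1) + Σ_{n mod p² : Σᵢ localExp ≥ 2}(z^{Σ localExp} − z)` EXACTLY, the last sum
having `≤ Σ deg fᵢ` terms (Hensel + no common roots), so `E_p(z) = 1 + (z−1)ω_f(p)/p + O(p⁻²)`; with
`log(1−1/p) = −1/p + O(p⁻²)` the log of the `p`-th factor is `(z−1)(ω_f(p) − k)/p + O(p⁻²)`; the ORDERED sum
`Σ_p (k − ω_f(p))/p` converges (`AZFG2020_tendsto_sum_sub_omega_div_holds`, PROVED) ⇒ the tail products converge
uniformly on the ball, the head `∏_{p ≤ P₁}` is entire, so the partial products converge locally uniformly and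
`limUnder` is holomorphic (`TendstoLocallyUniformlyOn.differentiableOn`, `Filter.Tendsto.limUnder_eq`).  At `z = 0`
the `N`-th partial product IS `(batemanHornPartial f N : ℂ)` (`E_p(0) = 1 − ω_f(p)/p` for every prime), whose limit
is `C(f)` (`IsBatemanHornSystem.hasBatemanHornConst_holds`). -/
theorem stub_eulerFactor :
    (∀ (k : ℕ) (f : Fin k → ℤ[X]), LocalCounts k f) → ∀ (k : ℕ) (f : Fin k → ℤ[X]), EulerFactorClause k f := by
  sorry

/-- **stub_levinFainleib** (L; classical — Levin–Faĭnleĭb 1967 / Halberstam–Richert Lemma 5.4 / Wirsing, in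
asymptotic form).  Route: (a) a priori `Σ_{d≤D} g(d)d^{−s} ≤ ∏_{p≤D} Σ_ν g(p^ν)p^{−νs}` (tree: HT (0.4)
`Literature.NumberTheory.LFunctions.HallTenenbaum.sum_div_le_prod_tsum`), so `F(s) = Σ g(d) d^{−s}` converges for
`s > 0` and equals `∏_p F_p(s)` (`ArithmeticFunction.IsMultiplicative.eulerProduct`); (b)
`Σ_p [log F_p(s) + κ log(1 − p^{−1−s})] → log P` as `s → 0⁺` — the `(g(p) − κ/p)p^{−s}` part by Abel
summation from (H1) and Mertens' first theorem (BOUNDED remainders ⇒ uniformly Cauchy in `s ≥ 0`), the rest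
absolutely; `ζ(1+s)s → 1` (`riemannZeta_residue_one`), so `s^κ F(s) → P` and the ordered product converges to
`P`; (c) the PROVED `HardyLittlewoodTauberianDirichlet_holds` with `a_n = n g(n) ≥ 0`, `β = κ`, `A = 0` gives
`Σ_{d≤D} g(d)/(log D)^κ → P/Γ(κ+1)`. -/
theorem stub_levinFainleib : ∀ (g : ℕ → ℝ) (κ : ℝ), LevinFainleibAsymp g κ := by
  sorry

/-- **stub_typeISandwich** (L; elementary).  Let `n₀` be such that every `fᵢ(n) ≥ 1` for `n ≥ n₀`
(`IsBatemanHornSystem.natDegree_pos`, positive leading coefficients).  For `n ≥ n₀`, `d ∈ tuples f n` iff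
`dᵢ ∣ fᵢ(n)` for all `i` (positive divisors), so `Σ_{n₀≤n≤x} = Σ_{m ≤ x} Σ_{d ∈ prodTuples k m} ∏h_y(dᵢ)·N'_d`
with `N'_d = #{n ∈ [n₀, x] : dᵢ ∣ fᵢ(n) ∀i}`; the condition is `tupleLcm d`-periodic
(`Polynomial.sub_dvd_eval_sub`), so `|N'_d − (x+1)·tupleDens f d| ≤ (1 + n₀)·tupleCount f d ≤ (1+n₀)·m·tupleDens f d`
(`Nat.filter_Ico_card_eq_of_periodic`; `tupleLcm d ≤ ∏ dᵢ = m`); the `n < n₀` contribute `≤ Σ_{n<n₀} y^{s_f(n)}`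
(weights `≥ 0` for `y ≥ 1`, full sum `= y^{s_f(n)}` by `pow_stat_eq_sum_tuples`). -/
theorem stub_typeISandwich :
    ∀ (k : ℕ) (f : Fin k → ℤ[X]), IsBatemanHornSystem f → ∀ y : ℝ, 1 ≤ y → TypeISandwich k f y := by
  sorry

/-- **stub_typeILocal** (XL; CRT bookkeeping).  Non-negativity (`y ≥ 1`) and `b(1) = 1` are immediate.
Multiplicativity: for coprime `m, n ≥ 1`, `prodTuples k (mn) ≃ prodTuples k m × prodTuples k n` via
`dᵢ ↦ (gcd(dᵢ,m), gcd(dᵢ,n))`, `h_y` is multiplicative (`thinWeight_mul`), `tupleLcm` is multiplicative and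
`tupleCount` is multiplicative by CRT on `range (L₁L₂)` (`Nat.chineseRemainder`; `dᵢ ∣ fᵢ(n)` depends on
`n mod dᵢ`, `Polynomial.sub_dvd_eval_sub`).  Prime powers: `prodTuples k p` = one slot `p` (`b(p) = (y−1)Σᵢρᵢ(p)/p`,
`polyRootCountMod_single`); a tuple `(p^{eᵢ})` with some `eᵢ ≥ 3` has weight `0` (`thinCoeff_of_three_le`), so
`b(p^ν) = 0` for `ν > 2k`; for `ν ≥ 2` either some `eᵢ = 2` (density `≤ deg fᵢ/p²`, `LocalCounts` (iii)) or two
slots `= p` (density `0`, `LocalCounts` (ii)), weights bounded, boundedly many tuples ⇒ `b(p^ν) ≤ C/p²`; finally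
`Σ_{ν≤2k} b(p^ν) = p⁻² Σ_{n mod p²} ∏ᵢ Σ_{e ≤ localExp p (fᵢ n)} thinCoeff y e = p⁻² Σ_n y^{Σᵢ localExp} = E_p(y)`
(`Finset.prod_univ_sum`, `sum_thinCoeff_range`). -/
theorem stub_typeILocal : (∀ (k : ℕ) (f : Fin k → ℤ[X]), LocalCounts k f) →
    ∀ (k : ℕ) (f : Fin k → ℤ[X]), IsBatemanHornSystem f → ∀ y : ℝ, 1 ≤ y → TypeILocal k f y := by
  sorry

/-- **stub_typeILimit** (L; analysis).  With `κ = k(y−1) ≥ 0` and `b = bCoeff f y`: (H1) for `b` is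
`RootMertens` for each `fᵢ` (irreducible, `natDegree_pos`) since `b(p) = (y−1)Σᵢρᵢ(p)/p`; (H2) from
`b(p) ≤ (y−1)(Σ deg fᵢ)/p` (`p ∤ lc`, else finitely many), `b(p^ν) ≤ C/p²` (`2 ≤ ν ≤ 2k`, `p > P₀`) and
`b(p^ν) = 0` (`ν > 2k`); `LevinFainleibAsymp b κ` ⇒ `G(x) := Σ_{m≤x} b(m) ∼ (P/Γ(κ+1))(log x)^κ` with
`P = lim ∏_{p≤N}(Σ_ν b(p^ν))(1−1/p)^κ`, and `eulerFactor f y = P` (the complex partial products are these real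
ones cast: `localFactor = Σ_ν b(p^ν)`, `exp(κ log(1−1/p)) = (1−1/p)^κ`; `Tendsto.limUnder_eq`).  Sandwich:
`T_x = (x+1)G(x) + O(1 + Σ_{m≤x} m b(m))` and `Σ_{m≤x} m b(m) ≤ εx G(εx) + x(G(x) − G(εx)) = o(x(log x)^κ)`
(every `ε`; `(log εx)^κ ∼ (log x)^κ`).  Normaliser: `exp(k(1−y) log log x) = (log x)^{−κ}` (`x ≥ 2`); cast to `ℂ`. -/
theorem stub_typeILimit :
    (∀ (k : ℕ) (f : Fin k → ℤ[X]), IsBatemanHornSystem f → ∀ y : ℝ, 1 ≤ y → TypeISandwich k f y) →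
    (∀ (k : ℕ) (f : Fin k → ℤ[X]), IsBatemanHornSystem f → ∀ y : ℝ, 1 ≤ y → TypeILocal k f y) →
    (∀ g : ℤ[X], RootMertens g) → (∀ (g : ℕ → ℝ) (κ : ℝ), LevinFainleibAsymp g κ) →
    ∀ (k : ℕ) (f : Fin k → ℤ[X]), IsBatemanHornSystem f → ∀ y : ℝ, 1 < y → TypeILaw k f y := by
  sorry

/-- **stub_betaKernel** (OPEN — the hardest stub, the lead's; by `typeISum_add_kernelSum` and `TypeILaw` it is
EQUIVALENT to the crux with `Λ = λ_f`, which `Negative.Structure.Λ_unique` forces anyway).  A POSITIVE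
root-count for the `fᵢ` modulo structured moduli `∏dᵢ ∈ (x, c x^{Σdeg fᵢ}]` in `[0, x]`, weighted by
`∏h_y(dᵢ) ≥ 0`, with the forced constant `λ_f(y)(D^{y−1}Γ(y)^{−k} − Γ(k(y−1)+1)^{−1})` (zero to first order at
`y = 1`; its `y`-derivative there is Dickman along `f`, open since Hooley 1967).  Certified slices today:
`x < Q ≤ x(log x)^c` (Hooley 1964, tree fact `hooley_polyRoots_equidistributed`); beyond `x^{1+δ}` nothing. -/
theorem stub_betaKernel :
    ∀ (k : ℕ) (f : Fin k → ℤ[X]), IsBatemanHornSystem f → ∀ y : ℝ, 5 / 4 < y → y < 7 / 4 →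
      BetaKernelLaw k f y := by
  sorry

/-! ### Glue, part 1 (PROVED): the thinned-divisor expansion `y^{s(m)} = Σ_{d ∣ m} h_y(d)` -/

section Identity

variable {R : Type*} [CommRing R]

/-- `h_y` as an arithmetic function (`0 ↦ 0`). -/
def thinArith (y : R) : ArithmeticFunction R :=
  ⟨fun d => if d = 0 then 0 else thinWeight y d, by simp⟩

theorem thinArith_apply (y : R) {d : ℕ} (hd : d ≠ 0) : thinArith y d = thinWeight y d := by
  simp [thinArith, hd]

theorem isMultiplicative_thinArith (y : R) : (thinArith y).IsMultiplicative := by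
  refine ⟨by simp [thinArith, thinWeight], ?_⟩
  intro m n hmn
  rcases eq_or_ne m 0 with rfl | hm
  · simp [thinArith]
  rcases eq_or_ne n 0 with rfl | hn
  · simp [thinArith]
  rw [thinArith_apply y (mul_ne_zero hm hn), thinArith_apply y hm, thinArith_apply y hn]
  exact thinWeight_mul y hm hn hmn

theorem capped_prime_pow {p : ℕ} (hp : p.Prime) (j : ℕ) : capped (p ^ j) = min j 2 := by
  rw [capped, hp.factorization_pow, Finsupp.sum_single_index (by simp)]

theorem capped_mul {m n : ℕ} (hm : m ≠ 0) (hn : n ≠ 0) (h : m.Coprime n) :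
    capped (m * n) = capped m + capped n := by
  unfold capped
  rw [Nat.factorization_mul hm hn, Finsupp.sum_add_index_of_disjoint]
  simpa only [Nat.support_factorization] using h.disjoint_primeFactors

/-- `m ↦ y^{s(m)}` as an arithmetic function (`0 ↦ 0`). -/
def cappedArith (y : R) : ArithmeticFunction R :=
  ⟨fun m => if m = 0 then 0 else y ^ capped m, by simp⟩

theorem cappedArith_apply (y : R) {m : ℕ} (hm : m ≠ 0) : cappedArith y m = y ^ capped m := by
  simp [cappedArith, hm]

theorem isMultiplicative_cappedArith (y : R) : (cappedArith y).IsMultiplicative := by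
  refine ⟨by simp [cappedArith, capped], ?_⟩
  intro m n hmn
  rcases eq_or_ne m 0 with rfl | hm
  · simp [cappedArith]
  rcases eq_or_ne n 0 with rfl | hn
  · simp [cappedArith]
  rw [cappedArith_apply y (mul_ne_zero hm hn), cappedArith_apply y hm, cappedArith_apply y hn,
    capped_mul hm hn hmn, pow_add]

theorem sum_thinCoeff_range_of_two_le (y : R) {j : ℕ} (hj : 2 ≤ j) :
    ∑ i ∈ range (j + 1), thinCoeff y i = y ^ 2 := by
  induction j, hj using Nat.le_induction with
  | base => simp [Finset.sum_range_succ]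
  | succ j hj ih =>
    rw [Finset.sum_range_succ, ih, thinCoeff_of_three_le y (by omega), add_zero]

/-- `Σ_{v ≤ j} thinCoeff y v = y^{min(j,2)}` — the local form of the expansion (also the identity
`Σ_ν b(p^ν) = E_p` behind `stub_typeIReduction`). -/
theorem sum_thinCoeff_range (y : R) (j : ℕ) :
    ∑ i ∈ range (j + 1), thinCoeff y i = y ^ min j 2 := by
  rcases Nat.lt_or_ge j 2 with hj | hj
  · interval_cases j <;> simp [Finset.sum_range_succ]
  · rw [min_eq_right hj, sum_thinCoeff_range_of_two_le y hj]

/-- Möbius inversion on prime powers: `h_y * ζ = y^{s}` as arithmetic functions. -/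
theorem thinArith_mul_zeta (y : R) :
    thinArith y * (ArithmeticFunction.zeta : ArithmeticFunction R) = cappedArith y := by
  rw [ArithmeticFunction.IsMultiplicative.eq_iff_eq_on_prime_powers _
    ((isMultiplicative_thinArith y).mul ArithmeticFunction.isMultiplicative_zeta.natCast) _
    (isMultiplicative_cappedArith y)]
  intro p i hp
  rw [ArithmeticFunction.coe_mul_zeta_apply, Nat.sum_divisors_prime_pow hp,
    cappedArith_apply y (pow_ne_zero _ hp.ne_zero), capped_prime_pow hp]
  rw [Finset.sum_congr rfl fun j _ => by
    rw [thinArith_apply y (pow_ne_zero _ hp.ne_zero), thinWeight_prime_pow y hp]]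
  exact sum_thinCoeff_range y i

/-- **THE EXPANSION** `y^{s(m)} = Σ_{d ∣ m} h_y(d)` for `m ≥ 1`. -/
theorem pow_capped_eq_sum_divisors (y : R) {m : ℕ} (hm : m ≠ 0) :
    y ^ capped m = ∑ d ∈ m.divisors, thinWeight y d := by
  have h : (thinArith y * (ArithmeticFunction.zeta : ArithmeticFunction R)) m = cappedArith y m := by
    rw [thinArith_mul_zeta]
  rw [ArithmeticFunction.coe_mul_zeta_apply, cappedArith_apply y hm] at h
  rw [← h]
  exact Finset.sum_congr rfl fun d hd => thinArith_apply y (Nat.pos_of_mem_divisors hd).ne'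

/-- The expansion with the `0 ↦ {1}` convention, for EVERY `m : ℕ`, with the crux's inner sum verbatim. -/
theorem pow_capped_eq_sum_divSet (y : R) (m : ℕ) :
    y ^ (m.factorization.sum fun _ v => min v 2) = ∑ d ∈ divSet m, thinWeight y d := by
  rcases eq_or_ne m 0 with rfl | hm
  · simp [divSet, thinWeight]
  · rw [divSet, max_eq_left (Nat.one_le_iff_ne_zero.2 hm)]
    exact pow_capped_eq_sum_divisors y hm

/-- The system expansion over divisor TUPLES: `y^{s_f(n)} = Σ_{d ∈ tuples f n} ∏ᵢ h_y(dᵢ)`. -/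
theorem pow_stat_eq_sum_tuples {k : ℕ} (f : Fin k → ℤ[X]) (y : R) (n : ℕ) :
    y ^ (∑ i, (((f i).eval (n : ℤ)).toNat.factorization.sum fun _ v => min v 2)) =
      ∑ d ∈ tuples f n, ∏ i, thinWeight y (d i) := by
  rw [← Finset.prod_pow_eq_pow_sum,
    Finset.prod_congr rfl fun i _ => pow_capped_eq_sum_divSet y ((f i).eval (n : ℤ)).toNat,
    tuples, Finset.prod_univ_sum]

end Identity

/-! ### Glue, part 2 (PROVED): the exact split `M_x = T_x + K_x` and the composition -/

/-- **The split is exact**: `T_x(y) + K_x(y) = Σ_{0≤n≤x} y^{s_f(n)}` for every family, `y`, `x`. -/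
theorem typeISum_add_kernelSum {k : ℕ} (f : Fin k → ℤ[X]) (y : ℝ) (x : ℕ) :
    typeISum f y x + kernelSum f y x =
      ∑ n ∈ range (x + 1), y ^ (∑ i, (((f i).eval (n : ℤ)).toNat.factorization.sum fun _ v => min v 2)) := by
  rw [typeISum, kernelSum, ← Finset.sum_add_distrib]
  refine Finset.sum_congr rfl fun n _ => ?_
  rw [pow_stat_eq_sum_tuples f y n]
  have hK : (tuples f n).filter (fun d => x < ∏ i, d i) =
      (tuples f n).filter (fun d => ¬ (∏ i, d i ≤ x)) :=
    Finset.filter_congr fun d _ => not_le.symm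
  rw [hK, Finset.sum_filter_add_sum_filter_not]

/-- The normalised sum of the crux splits into its Type-I and kernel parts (cast to `ℂ`). -/
theorem normSum_eq_typeI_add_kernel {k : ℕ} (f : Fin k → ℤ[X]) (y : ℝ) (x : ℕ) :
    (x : ℂ)⁻¹ * Complex.exp ((k : ℂ) * (1 - (y : ℂ)) * (Real.log (Real.log x) : ℂ)) *
        ∑ n ∈ range (x + 1), (y : ℂ) ^ (∑ i, (((f i).eval (n : ℤ)).toNat.factorization.sum fun _ v => min v 2))
      = (x : ℂ)⁻¹ * Complex.exp ((k : ℂ) * (1 - (y : ℂ)) * (Real.log (Real.log x) : ℂ)) * (typeISum f y x : ℂ)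
        + (x : ℂ)⁻¹ * Complex.exp ((k : ℂ) * (1 - (y : ℂ)) * (Real.log (Real.log x) : ℂ)) *
          (kernelSum f y x : ℂ) := by
  rw [← mul_add, ← Complex.ofReal_add, typeISum_add_kernelSum]
  push_cast
  rfl

/-- **Segment law from the two halves**: `TypeILaw` and `BetaKernelLaw` give the crux's real-segment
law with the EXPLICIT `Λ = eulerFactor f` (limits add; the constants add up by `ring`). -/
theorem segmentLaw_of_parts
    (hT : ∀ (k : ℕ) (f : Fin k → ℤ[X]), IsBatemanHornSystem f → ∀ y : ℝ, 1 < y → TypeILaw k f y)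
    (hK : ∀ (k : ℕ) (f : Fin k → ℤ[X]), IsBatemanHornSystem f → ∀ y : ℝ, 5 / 4 < y → y < 7 / 4 →
      BetaKernelLaw k f y)
    {k : ℕ} {f : Fin k → ℤ[X]} (hf : IsBatemanHornSystem f) (y : ℝ) (hy : 5 / 4 < y) (hy' : y < 7 / 4) :
    Tendsto (fun x : ℕ => (x : ℂ)⁻¹ * Complex.exp ((k : ℂ) * (1 - (y : ℂ)) * (Real.log (Real.log x) : ℂ)) *
        ∑ n ∈ range (x + 1), (y : ℂ) ^ (∑ i, (((f i).eval (n : ℤ)).toNat.factorization.sum fun _ v => min v 2)))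
      atTop
      (𝓝 (eulerFactor f y * Complex.exp (((y : ℂ) - 1) * (Real.log (∏ i, ((f i).natDegree : ℝ)) : ℂ)) *
        (Complex.Gamma y)⁻¹ ^ k)) := by
  have h1 := hT k f hf y (by linarith)
  have h2 := hK k f hf y hy hy'
  have h3 := (h1.add h2).congr fun x => (normSum_eq_typeI_add_kernel f y x).symm
  convert h3 using 2
  ring

/-- **Composition, hypothesis form** (real proof, standard axioms):
`EulerFactorClause → TypeILaw → BetaKernelLaw → SystemLSDRealSegment`, with `Λ := eulerFactor f`. -/
theorem systemLSDRealSegment_of_parts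
    (hE : ∀ (k : ℕ) (f : Fin k → ℤ[X]), EulerFactorClause k f)
    (hT : ∀ (k : ℕ) (f : Fin k → ℤ[X]), IsBatemanHornSystem f → ∀ y : ℝ, 1 < y → TypeILaw k f y)
    (hK : ∀ (k : ℕ) (f : Fin k → ℤ[X]), IsBatemanHornSystem f → ∀ y : ℝ, 5 / 4 < y → y < 7 / 4 →
      BetaKernelLaw k f y) :
    SystemLSDRealSegment := fun k f hf =>
  ⟨eulerFactor f, (hE k f hf).1, (hE k f hf).2, fun y hy hy' => segmentLaw_of_parts hT hK hf y hy hy'⟩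

/-- **Uniqueness check against the landed Negative lemma** `Negative.Structure.Λ_unique`: under the
three laws, ANY `Λ` holomorphic on the ball satisfying the crux's segment law for `f` coincides with
`eulerFactor f` on `|z| < 2` — the line produces exactly the function the identity theorem pins. -/
theorem eulerFactor_unique_of_parts
    (hE : ∀ (k : ℕ) (f : Fin k → ℤ[X]), EulerFactorClause k f)
    (hT : ∀ (k : ℕ) (f : Fin k → ℤ[X]), IsBatemanHornSystem f → ∀ y : ℝ, 1 < y → TypeILaw k f y)
    (hK : ∀ (k : ℕ) (f : Fin k → ℤ[X]), IsBatemanHornSystem f → ∀ y : ℝ, 5 / 4 < y → y < 7 / 4 →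
      BetaKernelLaw k f y)
    {k : ℕ} {f : Fin k → ℤ[X]} (hf : IsBatemanHornSystem f) {Λ : ℂ → ℂ}
    (hΛ : DifferentiableOn ℂ Λ (Metric.ball 0 2))
    (hlaw : ∀ y : ℝ, 5 / 4 < y → y < 7 / 4 →
      Tendsto (fun x : ℕ => (x : ℂ)⁻¹ * Complex.exp ((k : ℂ) * (1 - (y : ℂ)) * (Real.log (Real.log x) : ℂ)) *
          ∑ n ∈ range (x + 1), (y : ℂ) ^ (∑ i, (((f i).eval (n : ℤ)).toNat.factorization.sum fun _ v => min v 2)))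
        atTop
        (𝓝 (Λ y * Complex.exp (((y : ℂ) - 1) * (Real.log (∏ i, ((f i).natDegree : ℝ)) : ℂ)) *
          (Complex.Gamma y)⁻¹ ^ k))) :
    Set.EqOn Λ (eulerFactor f) (Metric.ball 0 2) := by
  refine Summit.Parity.BatemanHorn.Theorems.SystemLSDRealSegment.Negative.Λ_unique (k := k) (f := f) hΛ
    (hE k f hf).1 (fun y hy hy' => ?_) (fun y hy hy' => ?_)
  · simpa only [mul_assoc] using hlaw y hy hy'
  · simpa only [mul_assoc] using segmentLaw_of_parts hT hK hf y hy hy'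

/-- **The skeleton theorem**: the crux BY NAME from the seven stubs. -/
theorem SystemLSDRealSegment_of : SystemLSDRealSegment :=
  systemLSDRealSegment_of_parts (stub_eulerFactor stub_congruenceFacts.2)
    (stub_typeILimit stub_typeISandwich (stub_typeILocal stub_congruenceFacts.2) stub_congruenceFacts.1
      stub_levinFainleib)
    stub_betaKernel

end

end Summit.Parity.BatemanHorn.Cruxes.SystemLSDRealSegment.BetaThinnedRootKernel
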